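import Literature.AnabelianGeometry.AbsoluteAnabelian.AbsTopIProp23ClosedSurfaceModelProofs
import Literature.AnabelianGeometry.AbsoluteAnabelian.AbsTopIThm214GroupPartHolds
import Literature.AnabelianGeometry.AbsoluteAnabelian.AbsTopIThm17Proofs
import Literature.AnabelianGeometry.SemiGraphs.ProSigmaCompletionModels
import Literature.AnabelianGeometry.SemiGraphs.ProSigmaCompletionTransport
import HarnessLib

/-!
# [AbsTopI] Prop 2.2 / Prop 2.3 (i), (ii) / Thm 2.14 (i) as typed — universal closures REFUTED,
# instance forms PROVED at an explicit closed-surface model (FACT-LIST rows F-0240, F-0239, F-0238, F-0245)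

Topic `AnabelianGeometry/AbsoluteAnabelian`, namespace
`Literature.AnabelianGeometry.AbsoluteAnabelian.FundamentalExtension`.  PROOF-ONLY companion of
`AbsTopISemiAbsolute.lean` (abc-iut-L4-t4): THEOREMS ONLY — no definition, no named fact, no instance.
abc-iut cell, block F (fact-proving wave), seat abc-iut-f-089, tranche 89.

S. Mochizuki, *Topics in Absolute Anabelian Geometry I: Generalities* (2012) [AbsTopI]: Prop 2.2 p. 18
("Any profinite group `Δ` of GFG-type is topologically finitely generated"), Prop 2.3 p. 19 ((i) "`Δ`
is slim and elastic", (ii) "`Π` is slim, but not elastic"), Thm 2.14 (i) p. 33 ("`p₁ = p₂`,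
`Σ₁ = Σ₂`; `φ` induces isomorphisms `Δ₁ ≅ Δ₂`, `G₁ ≅ G₂`").  abc-iut-L4-t4 typed the CONCLUSIONS as
predicates on an ABSTRACT extension `E : 1 → Δ → Π → G → 1` (`FundamentalExtension`, data = two
profinite groups and a continuous surjection) resp. on abstract `(B₁, B₂, φ)`:
`E.GeomTFG`, `E.GeomSlimElastic`, `E.ArithSlimNotElastic`, `Thm214GroupPart B₁ B₂ φ` — the printed
HYPOTHESES ("of GFG-type", "of GSAFG-type", "of AFG-type", "arising from a hyperbolic (orbi)curve", Def 2.1) are NOT part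
of the typed datum.  Consequently (cell rule R5: a parametrised predicate is consumable AT NAMED
INSTANCES ONLY, never as a closed fact) this file records, for each of the four rows:

* **(A) the universal closure over the abstract data is FALSE** — kernel counterexamples built from
  Mathlib data only: the split extension `A × G_k → G_k` (`ContinuousMonoidHom.snd`) with
  `A = G_ℚ` (then `Δ ≅ G_ℚ` is not topologically finitely generated, tree
  `not_isTopologicallyFinitelyGenerated_absoluteGaloisGroup`: refutes `∀ E, E.GeomTFG`, even among
  extensions carrying MLF base data); `Π = ℤ/2`, `G = 1`, and the split `ℤ/2 × G_{ℚ_2} → G_{ℚ_2}`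
  (`Δ ≅ ℤ/2` is abelian and nontrivial, hence not slim: refutes `∀ E, E.GeomSlimElastic`); the extension
  `Π = G = G_k`, `aug = id` of `FundamentalExtensionBaseNonVacuity.lean` (`Π = G_k` IS elastic, tree
  `isElastic_absoluteGaloisGroup` = [AbsTopI] Thm 1.7 (ii): refutes `∀ E (B : E.MLFBase),
  E.ArithSlimNotElastic` — the hypothesis `Δ ≠ 1` of the tree's reduction `MLFBase.arithSlimNotElastic'`
  cannot be dropped; NF analogue via `isElastic_absoluteGaloisGroup_numberField`); and
  `Π = G_{ℚ_2} × G_{ℚ_3}` read once with `aug = snd` (base `ℚ_3`) and once with `aug = fst` (base `ℚ_2`),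
  `φ = id` (then "`p₁ = p₂`" reads `3 = 2`: refutes `∀ E F B₁ B₂ φ, Thm214GroupPart B₁ B₂ φ`; the tree's
  `PreservesGeom.thm214GroupPart` shows the `Δ`-preserving `φ` all satisfy it);
* **(B) the instance form HOLDS at an explicit model** — the SPLIT CLOSED-SURFACE MODEL
  `Ŝ_g × G_k → G_k`, `Ŝ_g = ` the profinite completion of the surface group `Γ_{g,0}` (`g ≥ 2`; Mathlib's
  `ProfiniteGrp.ProfiniteCompletion`, a pro-`Σ` completion for `Σ = Primes` by the tree's
  `isProSigmaCompletion_toCompletion`), `k/ℚ_p` finite: here `Δ = Ŝ_g × 1 ≅ Ŝ_g`, so the tree's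
  model theorem `prop22_prop23_of_isProSigmaCompletion_closedSurfaceGroup_mlf` (abc-iut, file
  `AbsTopIProp23ClosedSurfaceModelProofs.lean`) yields `GeomTFG ∧ GeomSlimElastic ∧ ArithSlimNotElastic`,
  and `PreservesGeom.thm214GroupPart` yields `Thm214GroupPart B B id`; fully closed instances at
  `g = 2`, `k = ℚ_2`.

HONEST SCOPE.  (A) refutes the universal closure of a TYPED SCHEMA, not the printed propositions (whose
hypotheses exclude every counterexample here); (B) is MODEL-level: the split extension is NOT claimed to
arise from a curve (for a hyperbolic curve over an MLF the extension `1 → Δ_X → Π_X → G_k → 1` is not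
asserted to split), it is the simplest extension of the typed interface whose `Δ` is a genuine pro-finite
surface group; for an abstract `E` the predicates stay hypotheses.  Nothing here bears on [IUTchIII]
Cor. 3.12; typed ≠ proved elsewhere; no side taken.

## References

* S. Mochizuki, *Topics in Absolute Anabelian Geometry I: Generalities*, J. Math. Sci. Univ. Tokyo 19
  (2012), Prop 2.2 p. 18, Prop 2.3 p. 19, Thm 2.14 (i) p. 33, Thm 1.7 p. 14. [MochizukiAbsTopI2012]
* S. Mochizuki, *Semi-graphs of Anabelioids*, Publ. RIMS 42 (2006), Ex. 2.10 p. 31. [MochizukiSemiAnbd2006]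
-/

noncomputable section

namespace Literature.AnabelianGeometry.AbsoluteAnabelian.FundamentalExtension

open Field
open Literature.AlgebraicGeometry.Frobenioids (IsSlimGroup)
open Literature.AnabelianGeometry.SemiGraphs.SemiGraphOfAnabelioids
open Literature.GroupTheory.CombinatorialGroupTheory
open Literature.IUT.HodgeTheaters (profiniteCompletion toCompletion)

/-! ### The split extension `A × G_k → G_k`: its `Δ` is a copy of `A` -/

/-- For a profinite group `A` and a field `k` of characteristic zero, the geometric subgroup
`Δ = Ker(pr₂) = A × 1` of the split extension `A × G_k → G_k` is isomorphic to `A` as a topological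
group (`a ↦ (a, 1)`). [folklore] -/
private theorem nonempty_equiv_geom_split (A : ProfiniteGrp.{0}) (k : Type) [Field k] [CharZero k] :
    Nonempty (A ≃ₜ*
      ↥(({ arith := ProfiniteGrp.of (A × absoluteGaloisGroup k)
           gal := absoluteGaloisGrp k
           aug := ContinuousMonoidHom.snd _ _
           aug_surjective := fun y => ⟨(1, y), rfl⟩ } : FundamentalExtension.{0}).geom)) := by
  refine ⟨{ toFun := fun a => ⟨(a, 1), rfl⟩
            invFun := fun x => x.1.1
            left_inv := fun _ => rfl
            right_inv := ?_
            map_mul' := fun _ _ => rfl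
            continuous_toFun := ?_
            continuous_invFun := continuous_fst.comp continuous_subtype_val }⟩
  · rintro ⟨⟨a, y⟩, hy⟩
    have hy' : y = 1 := hy
    subst hy'
    rfl
  · exact (continuous_id.prodMk continuous_const).subtype_mk _

/-! ### (A) F-0240 `GeomTFG` ([AbsTopI] Prop 2.2): universal closure REFUTED -/

/-- **F-0240, counterexample.**  The split extension `G_ℚ × G_{ℚ_2} → G_{ℚ_2}` — an extension of
profinite groups carrying MLF base data — has `Δ ≅ G_ℚ`, which is NOT topologically finitely generated
(tree: `not_isTopologicallyFinitelyGenerated_absoluteGaloisGroup`, [AbsTopI] Thm 1.7 (iii)); so the typed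
predicate `GeomTFG` FAILS for it.  (It is not "of GFG-type": Prop 2.2 itself is untouched.)
[cite: MochizukiAbsTopI2012, Prop 2.2 p.18] -/
theorem not_geomTFG_split_absoluteGaloisGroup_rat :
    ¬ ({ arith := ProfiniteGrp.of (absoluteGaloisGrp ℚ × absoluteGaloisGroup ℚ_[2])
         gal := absoluteGaloisGrp ℚ_[2]
         aug := ContinuousMonoidHom.snd _ _
         aug_surjective := fun y => ⟨(1, y), rfl⟩ } : FundamentalExtension.{0}).GeomTFG := by
  intro h
  obtain ⟨e⟩ := nonempty_equiv_geom_split (absoluteGaloisGrp ℚ) ℚ_[2]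
  exact not_isTopologicallyFinitelyGenerated_absoluteGaloisGroup ℚ
    (IsTopologicallyFinitelyGenerated.of_continuousMulEquiv e.symm h)

/-- **F-0240: the universal closure of the typed Prop 2.2 predicate is FALSE, even restricted to
extensions with MLF base data** (`E.MLFBase`): witness `G_ℚ × G_{ℚ_2} → G_{ℚ_2}` with base `ℚ_2`.
(R5: `GeomTFG` is consumable at named instances only.) [cite: MochizukiAbsTopI2012, Prop 2.2 p.18] -/
theorem not_forall_mlfBase_geomTFG :
    ¬ ∀ (E : FundamentalExtension.{0}) (_ : E.MLFBase), E.GeomTFG := fun h =>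
  not_geomTFG_split_absoluteGaloisGroup_rat
    (h _ { p := 2, K := ℚ_[2], galIso := ContinuousMulEquiv.refl _ })

/-- **F-0240: the universal closure `∀ E, E.GeomTFG` is FALSE.**
[cite: MochizukiAbsTopI2012, Prop 2.2 p.18] -/
theorem not_forall_geomTFG : ¬ ∀ E : FundamentalExtension.{0}, E.GeomTFG := fun h =>
  not_forall_mlfBase_geomTFG fun E _ => h E

/-! ### (A) F-0239 `GeomSlimElastic` ([AbsTopI] Prop 2.3 (i)): universal closure REFUTED -/

/-- A commutative topological group with an element `x ≠ 1` is not slim: the centraliser of the open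
subgroup `⊤` contains `x`. [folklore] -/
private theorem false_of_isSlimGroup_of_comm {G : Type} [Group G] [TopologicalSpace G]
    (h : IsSlimGroup G) (hcomm : ∀ a b : G, a * b = b * a) (x : G) (hx : x ≠ 1) : False := by
  have hc := h.centralizer_eq_bot ⊤ isOpen_univ
  have hmem : x ∈ Subgroup.centralizer ((⊤ : Subgroup G) : Set G) :=
    Subgroup.mem_centralizer_iff.mpr fun g _ => hcomm g x
  rw [hc] at hmem
  exact hx (Subgroup.mem_bot.mp hmem)

/-- Transport form: if `H ≅ G` (topological groups) with `G` commutative and `x ≠ 1` in `G`, then `H`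
is not slim. [folklore] -/
private theorem false_of_isSlimGroup_of_comm_equiv {G H : Type} [Group G] [TopologicalSpace G]
    [Group H] [TopologicalSpace H] (h : IsSlimGroup H) (e : G ≃ₜ* H)
    (hcomm : ∀ a b : G, a * b = b * a) (x : G) (hx : x ≠ 1) : False := by
  refine false_of_isSlimGroup_of_comm h (fun a b => ?_) (e x) fun hex => hx ?_
  · obtain ⟨a', rfl⟩ := e.surjective a
    obtain ⟨b', rfl⟩ := e.surjective b
    rw [← map_mul, hcomm, map_mul]
  · exact e.injective (hex.trans (map_one e).symm)

/-- **F-0239, counterexample.**  The degenerate extension `Π = ℤ/2` (discrete), `G = 1`: here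
`Δ = Π = ℤ/2` is abelian and nontrivial, so the centraliser of the open subgroup `Δ` is all of
`Δ ≠ 1` — `Δ` is NOT slim, and the typed predicate `GeomSlimElastic` FAILS.
[cite: MochizukiAbsTopI2012, Prop 2.3 (i) p.19] -/
theorem not_geomSlimElastic_zmod2 :
    ¬ ({ arith := ProfiniteGrp.ofFiniteGrp (FiniteGrp.of (Multiplicative (ZMod 2)))
         gal := ProfiniteGrp.ofFiniteGrp (FiniteGrp.of PUnit.{1})
         aug := 1
         aug_surjective := fun _ => ⟨1, rfl⟩ } :
         FundamentalExtension.{0}).GeomSlimElastic := by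
  rintro ⟨hslim, -⟩
  refine false_of_isSlimGroup_of_comm hslim (fun a b => Subtype.ext ?_)
    ⟨Multiplicative.ofAdd (1 : ZMod 2), rfl⟩ (fun h => ?_)
  · exact @mul_comm (Multiplicative (ZMod 2)) _ a.1 b.1
  · have h' : Multiplicative.ofAdd (1 : ZMod 2) = Multiplicative.ofAdd 0 := congrArg Subtype.val h
    exact one_ne_zero (Multiplicative.ofAdd.injective h')

/-- **F-0239, counterexample with MLF base.**  The split extension `ℤ/2 × G_{ℚ_2} → G_{ℚ_2}` carries
MLF base data and has `Δ ≅ ℤ/2` abelian and nontrivial, hence NOT slim: `GeomSlimElastic` FAILS for it.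
[cite: MochizukiAbsTopI2012, Prop 2.3 (i) p.19] -/
theorem not_geomSlimElastic_split_zmod2 :
    ¬ ({ arith := ProfiniteGrp.of
           (ProfiniteGrp.ofFiniteGrp (FiniteGrp.of (Multiplicative (ZMod 2))) × absoluteGaloisGroup ℚ_[2])
         gal := absoluteGaloisGrp ℚ_[2]
         aug := ContinuousMonoidHom.snd _ _
         aug_surjective := fun y => ⟨(1, y), rfl⟩ } : FundamentalExtension.{0}).GeomSlimElastic := by
  rintro ⟨hslim, -⟩
  obtain ⟨e⟩ :=
    nonempty_equiv_geom_split (ProfiniteGrp.ofFiniteGrp (FiniteGrp.of (Multiplicative (ZMod 2)))) ℚ_[2]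
  refine false_of_isSlimGroup_of_comm_equiv hslim e (fun a b => @mul_comm (Multiplicative (ZMod 2)) _ a b)
    (Multiplicative.ofAdd (1 : ZMod 2)) fun h1 => ?_
  have h2 : (1 : ZMod 2) = 0 :=
    Multiplicative.ofAdd.injective
      ((h1.trans (rfl : (1 : Multiplicative (ZMod 2)) = Multiplicative.ofAdd 0)) :
        Multiplicative.ofAdd (1 : ZMod 2) = Multiplicative.ofAdd 0)
  exact one_ne_zero h2

/-- **F-0239: the universal closure is FALSE even restricted to extensions with MLF base data**:
witness `ℤ/2 × G_{ℚ_2} → G_{ℚ_2}` with base `ℚ_2`. [cite: MochizukiAbsTopI2012, Prop 2.3 (i) p.19] -/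
theorem not_forall_mlfBase_geomSlimElastic :
    ¬ ∀ (E : FundamentalExtension.{0}) (_ : E.MLFBase), E.GeomSlimElastic := fun h =>
  not_geomSlimElastic_split_zmod2 (h _ { p := 2, K := ℚ_[2], galIso := ContinuousMulEquiv.refl _ })

/-- **F-0239: the universal closure `∀ E, E.GeomSlimElastic` is FALSE.** (R5: `GeomSlimElastic` is
consumable at named instances only.) [cite: MochizukiAbsTopI2012, Prop 2.3 (i) p.19] -/
theorem not_forall_geomSlimElastic : ¬ ∀ E : FundamentalExtension.{0}, E.GeomSlimElastic := fun h =>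
  not_geomSlimElastic_zmod2 (h _)

/-! ### (A) F-0238 `ArithSlimNotElastic` ([AbsTopI] Prop 2.3 (ii)): universal closure REFUTED -/

/-- **F-0238, counterexample with MLF base.**  The degenerate extension `Π = G = G_K`, `aug = id`
(`K/ℚ_p` finite; `Δ = 1`) carries MLF base data, and its `Π = G_K` IS elastic ([AbsTopI] Thm 1.7 (ii),
tree `isElastic_absoluteGaloisGroup`); so "`Π` is slim, but not elastic" FAILS for it: the hypothesis
`Δ ≠ 1` of the tree's reduction `MLFBase.arithSlimNotElastic'` cannot be dropped.
[cite: MochizukiAbsTopI2012, Prop 2.3 (ii) p.19] -/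
theorem not_arithSlimNotElastic_absoluteGaloisGroup (p : ℕ) [Fact p.Prime] (K : Type) [Field K]
    [CharZero K] [Algebra ℚ_[p] K] [FiniteDimensional ℚ_[p] K] :
    ¬ ({ arith := absoluteGaloisGrp K
         gal := absoluteGaloisGrp K
         aug := ContinuousMonoidHom.id _
         aug_surjective := Function.surjective_id } : FundamentalExtension.{0}).ArithSlimNotElastic := by
  rintro ⟨-, h⟩
  exact h (isElastic_absoluteGaloisGroup p K)

/-- **F-0238, counterexample with NF base.**  The degenerate extension `Π = G = G_F`, `aug = id` (`F` a
number field) carries NF base data, and `Π = G_F` IS elastic ([AbsTopI] Thm 1.7 (iii), tree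
`isElastic_absoluteGaloisGroup_numberField`); so `ArithSlimNotElastic` FAILS for it.
[cite: MochizukiAbsTopI2012, Prop 2.3 (ii) p.19] -/
theorem not_arithSlimNotElastic_absoluteGaloisGroup_numberField (F : Type) [Field F] [NumberField F] :
    ¬ ({ arith := absoluteGaloisGrp F
         gal := absoluteGaloisGrp F
         aug := ContinuousMonoidHom.id _
         aug_surjective := Function.surjective_id } : FundamentalExtension.{0}).ArithSlimNotElastic := by
  rintro ⟨-, h⟩
  exact h (isElastic_absoluteGaloisGroup_numberField F)

/-- **F-0238: the universal closure is FALSE even restricted to extensions with MLF base data**: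
witness `Π = G = G_{ℚ_2}`. [cite: MochizukiAbsTopI2012, Prop 2.3 (ii) p.19] -/
theorem not_forall_mlfBase_arithSlimNotElastic :
    ¬ ∀ (E : FundamentalExtension.{0}) (_ : E.MLFBase), E.ArithSlimNotElastic := fun h =>
  not_arithSlimNotElastic_absoluteGaloisGroup 2 ℚ_[2]
    (h _ { p := 2, K := ℚ_[2], galIso := ContinuousMulEquiv.refl _ })

/-- **F-0238: the universal closure is FALSE even restricted to extensions with NF base data**:
witness `Π = G = G_ℚ`. [cite: MochizukiAbsTopI2012, Prop 2.3 (ii) p.19] -/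
theorem not_forall_nfBase_arithSlimNotElastic :
    ¬ ∀ (E : FundamentalExtension.{0}) (_ : E.NFBase), E.ArithSlimNotElastic := fun h =>
  not_arithSlimNotElastic_absoluteGaloisGroup_numberField ℚ
    (h _ { F := ℚ, galIso := ContinuousMulEquiv.refl _ })

/-- **F-0238: the universal closure `∀ E, E.ArithSlimNotElastic` is FALSE.** (R5: consumable at named
instances only.) [cite: MochizukiAbsTopI2012, Prop 2.3 (ii) p.19] -/
theorem not_forall_arithSlimNotElastic : ¬ ∀ E : FundamentalExtension.{0}, E.ArithSlimNotElastic :=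
  fun h => not_forall_mlfBase_arithSlimNotElastic fun E _ => h E

/-! ### (A) F-0245 `Thm214GroupPart` ([AbsTopI] Thm 2.14 (i), group part): universal closure REFUTED -/

/-- **F-0245, counterexample.**  Read the profinite group `Π = G_{ℚ_2} × G_{ℚ_3}` once as the split
extension over `G_{ℚ_3}` (`aug = pr₂`, MLF base `ℚ_3`) and once as the split extension over `G_{ℚ_2}`
(`aug = pr₁`, MLF base `ℚ_2`), and let `φ = id_Π`.  Then the first clause "`p₁ = p₂`" of the typed
Thm 2.14 (i) reads `3 = 2`: the predicate FAILS.  (`φ` does not carry `Δ₁ = G_{ℚ_2} × 1` to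
`Δ₂ = 1 × G_{ℚ_3}`; by the tree's `PreservesGeom.thm214GroupPart` every `Δ`-preserving `φ` satisfies the
predicate.) [cite: MochizukiAbsTopI2012, Thm 2.14 (i) p.33] -/
theorem not_thm214GroupPart_prod_swap :
    ¬ Thm214GroupPart
        (E := { arith := ProfiniteGrp.of (absoluteGaloisGrp ℚ_[2] × absoluteGaloisGroup ℚ_[3])
                gal := absoluteGaloisGrp ℚ_[3]
                aug := ContinuousMonoidHom.snd _ _
                aug_surjective := fun y => ⟨(1, y), rfl⟩ })
        (F := { arith := ProfiniteGrp.of (absoluteGaloisGrp ℚ_[2] × absoluteGaloisGroup ℚ_[3])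
                gal := absoluteGaloisGrp ℚ_[2]
                aug := ContinuousMonoidHom.fst _ _
                aug_surjective := fun x => ⟨(x, 1), rfl⟩ })
        { p := 3, K := ℚ_[3], galIso := ContinuousMulEquiv.refl _ }
        { p := 2, K := ℚ_[2], galIso := ContinuousMulEquiv.refl _ }
        (ContinuousMulEquiv.refl _) := by
  intro h
  exact absurd h.1 (show (3 : ℕ) ≠ 2 by decide)

/-- **F-0245: the universal closure `∀ E F (B₁ : E.MLFBase) (B₂ : F.MLFBase) (φ : Π₁ ≃ Π₂),
Thm214GroupPart B₁ B₂ φ` is FALSE.** (R5: consumable at named instances — e.g. `Δ`-preserving `φ`,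
`PreservesGeom.thm214GroupPart` — only.) [cite: MochizukiAbsTopI2012, Thm 2.14 (i) p.33] -/
theorem not_forall_thm214GroupPart :
    ¬ ∀ (E F : FundamentalExtension.{0}) (B₁ : E.MLFBase) (B₂ : F.MLFBase)
        (φ : E.arith ≃ₜ* F.arith), Thm214GroupPart B₁ B₂ φ := fun h =>
  not_thm214GroupPart_prod_swap (h _ _ _ _ _)

/-! ### (B) The split closed-surface model `Ŝ_g × G_k → G_k`: all four predicates HOLD -/

/-- **The geometric subgroup of the split closed-surface model is a pro-finite surface group**: for
`g : ℕ` and `k` of characteristic zero, `Δ = Ŝ_g × 1` of `Ŝ_g × G_k → G_k` receives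
`Γ_{g,0} → Ŝ_g ≅ Δ`, a pro-`Σ` completion for `Σ = Primes` (tree `isProSigmaCompletion_toCompletion`,
transported along `Ŝ_g ≅ Δ` by `IsProSigmaCompletion.comp_continuousMulEquiv`).
[cite: MochizukiSemiAnbd2006, Ex. 2.10 p.31] -/
theorem exists_isProSigmaCompletion_geom_splitSurfaceModel (g : ℕ) (k : Type) [Field k] [CharZero k] :
    ∃ ι : PuncturedSurfaceGroup g 0 →*
        ↥(({ arith := ProfiniteGrp.of (profiniteCompletion (PuncturedSurfaceGroup g 0) ×
                        absoluteGaloisGroup k)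
             gal := absoluteGaloisGrp k
             aug := ContinuousMonoidHom.snd _ _
             aug_surjective := fun y => ⟨(1, y), rfl⟩ } : FundamentalExtension.{0}).geom),
      IsProSigmaCompletion {p : ℕ | p.Prime} ι := by
  obtain ⟨e⟩ := nonempty_equiv_geom_split (profiniteCompletion (PuncturedSurfaceGroup g 0)) k
  exact ⟨_, (IsProSigmaCompletion.isProSigmaCompletion_toCompletion
    (PuncturedSurfaceGroup g 0)).comp_continuousMulEquiv e⟩

/-- **[AbsTopI] Prop 2.2 + Prop 2.3 (i) + Prop 2.3 (ii) HOLD at the split closed-surface model**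
`Ŝ_g × G_k → G_k` (`g ≥ 2`, `k/ℚ_p` finite, MLF base data `(p, k, id)`): `Δ ≅ Ŝ_g` is topologically
finitely generated, slim and elastic, and `Π = Ŝ_g × G_k` is slim but not elastic — the tree's model
theorem `prop22_prop23_of_isProSigmaCompletion_closedSurfaceGroup_mlf` at `Σ = Primes`.
[cite: MochizukiAbsTopI2012, Prop 2.3 p.19] -/
theorem prop22_prop23_splitSurfaceModel (g : ℕ) (hg : 2 ≤ g) (p : ℕ) [Fact p.Prime] (k : Type)
    [Field k] [CharZero k] [Algebra ℚ_[p] k] [FiniteDimensional ℚ_[p] k] :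
    ({ arith := ProfiniteGrp.of (profiniteCompletion (PuncturedSurfaceGroup g 0) × absoluteGaloisGroup k)
       gal := absoluteGaloisGrp k
       aug := ContinuousMonoidHom.snd _ _
       aug_surjective := fun y => ⟨(1, y), rfl⟩ } : FundamentalExtension.{0}).GeomTFG ∧
    ({ arith := ProfiniteGrp.of (profiniteCompletion (PuncturedSurfaceGroup g 0) × absoluteGaloisGroup k)
       gal := absoluteGaloisGrp k
       aug := ContinuousMonoidHom.snd _ _
       aug_surjective := fun y => ⟨(1, y), rfl⟩ } : FundamentalExtension.{0}).GeomSlimElastic ∧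
    ({ arith := ProfiniteGrp.of (profiniteCompletion (PuncturedSurfaceGroup g 0) × absoluteGaloisGroup k)
       gal := absoluteGaloisGrp k
       aug := ContinuousMonoidHom.snd _ _
       aug_surjective := fun y => ⟨(1, y), rfl⟩ } : FundamentalExtension.{0}).ArithSlimNotElastic := by
  obtain ⟨ι, hι⟩ := exists_isProSigmaCompletion_geom_splitSurfaceModel g k
  exact prop22_prop23_of_isProSigmaCompletion_closedSurfaceGroup_mlf
    { p := p, K := k, galIso := ContinuousMulEquiv.refl _ } ⟨2, Nat.prime_two⟩ (fun _ h => h) hg ι hι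

/-- **F-0240 PROVED AT THE MODEL** (closed instance): `GeomTFG` for the split genus-2 surface model
over `ℚ_2`, `Ŝ_2 × G_{ℚ_2} → G_{ℚ_2}`. [cite: MochizukiAbsTopI2012, Prop 2.2 p.18] -/
theorem geomTFG_splitSurfaceModel_two :
    ({ arith := ProfiniteGrp.of (profiniteCompletion (PuncturedSurfaceGroup 2 0) × absoluteGaloisGroup ℚ_[2])
       gal := absoluteGaloisGrp ℚ_[2]
       aug := ContinuousMonoidHom.snd _ _
       aug_surjective := fun y => ⟨(1, y), rfl⟩ } : FundamentalExtension.{0}).GeomTFG :=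
  (prop22_prop23_splitSurfaceModel 2 le_rfl 2 ℚ_[2]).1

/-- **F-0239 PROVED AT THE MODEL** (closed instance): `GeomSlimElastic` — `Δ ≅ Ŝ_2` is slim and
elastic — for the split genus-2 surface model over `ℚ_2`. [cite: MochizukiAbsTopI2012, Prop 2.3 (i) p.19] -/
theorem geomSlimElastic_splitSurfaceModel_two :
    ({ arith := ProfiniteGrp.of (profiniteCompletion (PuncturedSurfaceGroup 2 0) × absoluteGaloisGroup ℚ_[2])
       gal := absoluteGaloisGrp ℚ_[2]
       aug := ContinuousMonoidHom.snd _ _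
       aug_surjective := fun y => ⟨(1, y), rfl⟩ } : FundamentalExtension.{0}).GeomSlimElastic :=
  (prop22_prop23_splitSurfaceModel 2 le_rfl 2 ℚ_[2]).2.1

/-- **F-0238 PROVED AT THE MODEL** (closed instance): `ArithSlimNotElastic` — `Π = Ŝ_2 × G_{ℚ_2}` is
slim but not elastic — for the split genus-2 surface model over `ℚ_2`.
[cite: MochizukiAbsTopI2012, Prop 2.3 (ii) p.19] -/
theorem arithSlimNotElastic_splitSurfaceModel_two :
    ({ arith := ProfiniteGrp.of (profiniteCompletion (PuncturedSurfaceGroup 2 0) × absoluteGaloisGroup ℚ_[2])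
       gal := absoluteGaloisGrp ℚ_[2]
       aug := ContinuousMonoidHom.snd _ _
       aug_surjective := fun y => ⟨(1, y), rfl⟩ } : FundamentalExtension.{0}).ArithSlimNotElastic :=
  (prop22_prop23_splitSurfaceModel 2 le_rfl 2 ℚ_[2]).2.2

/-- The identity of `Π` carries `Δ` onto `Δ` (for every extension). [folklore] -/
private theorem preservesGeom_refl' (E : FundamentalExtension.{0}) :
    PreservesGeom (ContinuousMulEquiv.refl E.arith) := by
  change E.geom.map _ = E.geom
  ext x
  exact ⟨fun ⟨y, hy, hyx⟩ => hyx ▸ hy, fun hx => ⟨x, hx, rfl⟩⟩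

/-- **F-0245 PROVED AT THE MODEL**: for the split closed-surface model `Ŝ_g × G_k → G_k` with its MLF
base data `(p, k, id)` on both sides and `φ = id_Π`, the typed group part of [AbsTopI] Thm 2.14 (i)
HOLDS ("`p = p`", `id(Δ) = Δ`, equal minimal almost-pro sets) — the tree's unconditional
`PreservesGeom.thm214GroupPart` at `φ = id`. [cite: MochizukiAbsTopI2012, Thm 2.14 (i) p.33] -/
theorem thm214GroupPart_refl_splitSurfaceModel (g : ℕ) (p : ℕ) [Fact p.Prime] (k : Type) [Field k]
    [CharZero k] [Algebra ℚ_[p] k] [FiniteDimensional ℚ_[p] k] :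
    Thm214GroupPart
      (E := { arith := ProfiniteGrp.of (profiniteCompletion (PuncturedSurfaceGroup g 0) ×
                         absoluteGaloisGroup k)
              gal := absoluteGaloisGrp k
              aug := ContinuousMonoidHom.snd _ _
              aug_surjective := fun y => ⟨(1, y), rfl⟩ })
      (F := { arith := ProfiniteGrp.of (profiniteCompletion (PuncturedSurfaceGroup g 0) ×
                         absoluteGaloisGroup k)
              gal := absoluteGaloisGrp k
              aug := ContinuousMonoidHom.snd _ _
              aug_surjective := fun y => ⟨(1, y), rfl⟩ })
      { p := p, K := k, galIso := ContinuousMulEquiv.refl _ }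
      { p := p, K := k, galIso := ContinuousMulEquiv.refl _ }
      (ContinuousMulEquiv.refl _) :=
  (preservesGeom_refl' _).thm214GroupPart _ _

/-- **F-0245 PROVED AT THE MODEL** (closed instance): the split genus-2 surface model over `ℚ_2`,
`φ = id`. [cite: MochizukiAbsTopI2012, Thm 2.14 (i) p.33] -/
theorem thm214GroupPart_refl_splitSurfaceModel_two :
    Thm214GroupPart
      (E := { arith := ProfiniteGrp.of (profiniteCompletion (PuncturedSurfaceGroup 2 0) ×
                         absoluteGaloisGroup ℚ_[2])
              gal := absoluteGaloisGrp ℚ_[2]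
              aug := ContinuousMonoidHom.snd _ _
              aug_surjective := fun y => ⟨(1, y), rfl⟩ })
      (F := { arith := ProfiniteGrp.of (profiniteCompletion (PuncturedSurfaceGroup 2 0) ×
                         absoluteGaloisGroup ℚ_[2])
              gal := absoluteGaloisGrp ℚ_[2]
              aug := ContinuousMonoidHom.snd _ _
              aug_surjective := fun y => ⟨(1, y), rfl⟩ })
      { p := 2, K := ℚ_[2], galIso := ContinuousMulEquiv.refl _ }
      { p := 2, K := ℚ_[2], galIso := ContinuousMulEquiv.refl _ }
      (ContinuousMulEquiv.refl _) :=
  thm214GroupPart_refl_splitSurfaceModel 2 2 ℚ_[2]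

end Literature.AnabelianGeometry.AbsoluteAnabelian.FundamentalExtension

end
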